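import Mathlib.LinearAlgebra.PiTensorProduct.Basis
import Mathlib.LinearAlgebra.TensorProduct.Basis
import Mathlib.RingTheory.TensorProduct.Free
import Mathlib.LinearAlgebra.Multilinear.Basis
import Literature.AlgebraicGeometry.Motives.HodgeTensorPowerProofs
import Literature.AlgebraicGeometry.Motives.HodgeStructureProofs
import HarnessLib

/-!
# Tensor powers of Hodge structures: opposedness (proof)

This file discharges the named fact `Literature.AlgebraicGeometry.Motives.HodgeStructure.isCompl_tensorPowerFiltration` of
`Literature/AlgebraicGeometry/Motives/HodgeTensor.lean` (a field of the standing-hypotheses class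
`Literature.AlgebraicGeometry.Motives.HodgeTensorFacts`) about the Hodge filtration
`F^p (V^{⊗r}) = Σ_{p ≤ Σ aₖ} ⨂ₖ F^{aₖ} V` (`HodgeStructure.tensorPowerFiltration`, pulled back to
`ℂ ⊗ V^{⊗r}` along `HodgeStructure.piTensorBaseChange`) of the `r`-th tensor power of a pure
`ℚ`-Hodge structure `H : HodgeStructure V n`, for an arbitrary `ℚ`-vector space `V` (no
finite-dimensionality) and all `r : ℕ`:

* `Literature.HodgeStructure.isCompl_tensorPowerFiltration_holds : isCompl_tensorPowerFiltration` —
  `F^p (V^{⊗r}) ⊕ conj F^q (V^{⊗r}) = ℂ ⊗ V^{⊗r}` for `p + q = r n + 1` (the tensor power is a Hodge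
  structure of weight `r n`).

The sibling `HodgeTensorPowerProofs.lean` discharges exhaustion and separation of the same
filtration and proves that `piTensorBaseChange` is bijective (`piTensorBaseChange_bijective`),
which is used here; the Hodge decomposition comes from `HodgeStructureProofs.lean`.

Source: P. Deligne, *Théorie de Hodge II*, Publ. Math. IHÉS 40 (1971): 1.1.12 (the filtration
on a tensor product of filtered objects, `F^p (A ⊗ B) = Σ_{a+b=p} F^a A ⊗ F^b B`) and Prop. 1.2.5
(`F`, `F̄` `n`-opposed ⟺ `A = ⊕_{p+q=n} A^{p,q}`, `F^p = ⊕_{i≥p} A^{i,n-i}`,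
`F̄^q = ⊕_{i ≤ n-q} A^{i,n-i}`), whence the tensor product of Hodge structures of weights `n`, `m`
is a Hodge structure of weight `n + m` with `(A ⊗ B)^{a,b} = ⊕ A^{p,q} ⊗ B^{a-p,b-q}`; as in
E. Cattani, F. El Zein, P. Griffiths, Lê D. T., *Hodge Theory* (Princeton Math. Notes 49, 2014),
§3.1.1.3 (p. 131) and Prop. 3.2.10 (p. 156).

## Proof

* `piTensorBaseChange V ι : ℂ ⊗ (⨂ᵢ V) → ⨂ᵢ (ℂ ⊗ V)` is bijective for finite `ι`
  (`piTensorBaseChange_bijective`, from `HodgeTensorPowerProofs.lean`).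
* Conjugation: `f (conj x) = ⨂ₜ conj yᵢ` whenever `f x = ⨂ₜ yᵢ` (`f = piTensorBaseChange`;
  `piTensorBaseChange_conj_of_eq_tprod`), because `f ∘ conj ∘ f⁻¹ ∘ ⨂ₜ` and `⨂ₜ ∘ conj` are
  `ℚ`-multilinear and agree on the pure-tensor `ℚ`-basis `cᵢ ⊗ vⱼ` of `ℂ ⊗ V`
  (`Basis.tensorProduct`, `Basis.ext_multilinear`). Hence `conj` carries the pull-back of
  `range (⨂ Sᵢ)` to the pull-back of `range (⨂ conj Sᵢ)`
  (`complexConj_comap_piTensorBaseChange_range_mapIncl`).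
* Hodge decomposition in basis form (`exists_basis_F_eq_span`): collecting bases of the pieces
  `V^{i,n-i}` (`DirectSum.IsInternal.collectedBasis`; the decomposition itself is Deligne's 1.2.5,
  discharged in `HodgeStructureProofs.lean`) gives a `ℂ`-basis `e` of `V_ℂ` with a degree `deg`
  such that `F^a = span {e σ | a ≤ deg σ}` and `conj F^a = span {e σ | deg σ ≤ n - a}`.
* In the tensor basis `E β = ⨂ₜ e (β k)` of `⨂^r V_ℂ` (`Basis.piTensorProduct`), graded by the
  total degree `Σ_k deg (β k)`: `F^p (V^{⊗r}) = f⁻¹ (span {E β | Σ deg ≥ p})`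
  (`tensorPowerFiltration_eq_comap_span`) and
  `conj F^q (V^{⊗r}) = f⁻¹ (span {E β | Σ deg ≤ rn - q})`
  (`complexConj_tensorPowerFiltration_eq_comap_span`); the key step is that the image of
  `⨂ₖ span (e '' Pₖ)` is `span {E β | β k ∈ Pₖ ∀ k}`
  (`HodgeTensorAux.range_mapIncl_span_basis_image`, by the coordinate formula
  `Basis.piTensorProduct_repr_tprod_apply`).
* For `p + q = rn + 1` the two index sets are complementary, spans of complementary parts of a
  basis are complementary subspaces (`HodgeTensorAux.isCompl_span_basis_image_compl`), and
  complements pull back along the bijection `f`.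

## References

* P. Deligne, *Théorie de Hodge II*, Publ. Math. IHÉS 40 (1971), 5–57, 1.1.12 and Prop. 1.2.5.
* E. Cattani, F. El Zein, P. A. Griffiths, Lê D. T. (eds.), *Hodge Theory*, Princeton
  Mathematical Notes 49 (2014), §3.1.1.3 and Prop. 3.2.10.
-/

open scoped TensorProduct PiTensorProduct

noncomputable section

namespace Literature.AlgebraicGeometry.Motives

universe u w

variable {V : Type u} [AddCommGroup V] [Module ℚ V]

/-! ### Generic linear algebra: spans of parts of a basis, tensor bases -/

namespace HodgeTensorAux

/-- In a tensor power of a module with basis `e`, the image of `⨂ₖ span (e '' Pₖ)` is the span of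
the tensor basis vectors `⨂ₜ e (β k)` (`Basis.piTensorProduct`) with `β k ∈ Pₖ` for all `k`:
`⊇` is clear, and `⊆` holds because the `β`-coordinate of `⨂ₜ mₖ` is `∏ₖ (e.repr mₖ) (β k)`
(`Basis.piTensorProduct_repr_tprod_apply`), which vanishes unless every `β k` lies in the support
of `mₖ ∈ span (e '' Pₖ)`, i.e. in `Pₖ`. [folklore] -/
theorem range_mapIncl_span_basis_image {R : Type*} [CommRing R] {M : Type*} [AddCommGroup M]
    [Module R M] {S : Type*} {ι : Type*} [Finite ι] (e : Module.Basis S R M) (P : ι → Set S) :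
    LinearMap.range (PiTensorProduct.mapIncl fun k => Submodule.span R (e '' P k)) =
      Submodule.span R ((Basis.piTensorProduct fun _ : ι => e) '' {β | ∀ k, β k ∈ P k}) := by
  cases nonempty_fintype ι
  apply le_antisymm
  · rw [PiTensorProduct.mapIncl, PiTensorProduct.map_range_eq_span_tprod, Submodule.span_le]
    rintro _ ⟨m, rfl⟩
    rw [SetLike.mem_coe, Module.Basis.mem_span_image]
    intro β hβ k
    rw [Finset.mem_coe, Finsupp.mem_support_iff, Basis.piTensorProduct_repr_tprod_apply] at hβ
    have hk : e.repr ((fun k => (Submodule.span R (e '' P k)).subtype (m k)) k) (β k) ≠ 0 :=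
      fun h0 => hβ (Finset.prod_eq_zero (Finset.mem_univ k) h0)
    have hm : ((m k : M)) ∈ Submodule.span R (e '' P k) := (m k).2
    rw [Module.Basis.mem_span_image] at hm
    exact hm (Finsupp.mem_support_iff.2 hk)
  · rw [Submodule.span_le]
    rintro _ ⟨β, hβ, rfl⟩
    refine ⟨PiTensorProduct.tprod R fun k => ⟨e (β k), Submodule.subset_span ⟨β k, hβ k, rfl⟩⟩, ?_⟩
    simp [Basis.piTensorProduct_apply]

/-- The spans of complementary parts of a basis are complementary subspaces. [folklore] -/
theorem isCompl_span_basis_image_compl {R : Type*} [Ring R] {M : Type*} [AddCommGroup M]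
    [Module R M] {S : Type*} (E : Module.Basis S R M) (B : Set S) :
    IsCompl (Submodule.span R (E '' B)) (Submodule.span R (E '' Bᶜ)) := by
  refine ⟨E.linearIndependent.disjoint_span_image disjoint_compl_right, ?_⟩
  rw [codisjoint_iff, ← Submodule.span_union, ← Set.image_union, Set.union_compl_self,
    Set.image_univ, E.span_eq]

end HodgeTensorAux

namespace HodgeStructure

/-! ### The comparison map `ℂ ⊗ (⨂ V) → ⨂ (ℂ ⊗ V)` is compatible with `conj` -/

/-- `piTensorBaseChange ((∏ cᵢ) ⊗ ⨂ₜ wᵢ) = ⨂ₜ (cᵢ ⊗ wᵢ)` (multilinearity of `⨂ₜ`). [folklore] -/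
theorem piTensorBaseChange_prod_tmul_tprod {ι : Type w} [Fintype ι] (c : ι → ℂ) (w : ι → V) :
    piTensorBaseChange V ι ((∏ i, c i) ⊗ₜ[ℚ] PiTensorProduct.tprod ℚ w) =
      PiTensorProduct.tprod ℂ fun i => c i ⊗ₜ[ℚ] w i := by
  rw [piTensorBaseChange_tmul_tprod]
  have : (fun i => c i ⊗ₜ[ℚ] w i) = fun i => c i • (ofRat (w i) : ℂ ⊗[ℚ] V) := by
    ext i
    simp [TensorProduct.smul_tmul']
  rw [this, MultilinearMap.map_smul_univ]

/-- Complex conjugation passes through `piTensorBaseChange` on pure tensors: if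
`piTensorBaseChange x = ⨂ₜ yᵢ` then `piTensorBaseChange (conj x) = ⨂ₜ (conj yᵢ)`. Proof: the
`ℚ`-linear map `c := f ∘ conj ∘ f⁻¹` on `⨂[ℂ] (ℂ ⊗ V)` (`f = piTensorBaseChange`, bijective by
`piTensorBaseChange_bijective`) satisfies `c (⨂ₜ yᵢ) = ⨂ₜ (conj yᵢ)`: both sides are
`ℚ`-multilinear in `y` and agree on tuples of pure tensors `cᵢ ⊗ vᵢ` (where both equal
`⨂ₜ (c̄ᵢ ⊗ vᵢ)`, by `piTensorBaseChange_prod_tmul_tprod`), which contain a `ℚ`-basis of `ℂ ⊗ V`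
(`Basis.tensorProduct`), so they agree (`Basis.ext_multilinear`). [folklore] -/
theorem piTensorBaseChange_conj_of_eq_tprod {ι : Type w} [Finite ι]
    {x : ℂ ⊗[ℚ] (⨂[ℚ] _ : ι, V)} {y : ι → ℂ ⊗[ℚ] V}
    (h : piTensorBaseChange V ι x = PiTensorProduct.tprod ℂ y) :
    piTensorBaseChange V ι (conj x) = PiTensorProduct.tprod ℂ fun i => conj (y i) := by
  cases nonempty_fintype ι
  set e := LinearEquiv.ofBijective _ (piTensorBaseChange_bijective V ι) with he_def
  have he : ∀ z, e z = piTensorBaseChange V ι z := fun z => rfl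
  let c : (⨂[ℂ] _ : ι, (ℂ ⊗[ℚ] V)) →ₗ[ℚ] ⨂[ℂ] _ : ι, (ℂ ⊗[ℚ] V) :=
    e.toLinearMap.restrictScalars ℚ ∘ₗ conj ∘ₗ e.symm.toLinearMap.restrictScalars ℚ
  have hc : ∀ t, c t = e (conj (e.symm t)) := fun t => rfl
  have key : (c.compMultilinearMap ((PiTensorProduct.tprod ℂ).restrictScalars ℚ) :
      MultilinearMap ℚ (fun _ : ι => ℂ ⊗[ℚ] V) _) =
      ((PiTensorProduct.tprod ℂ).restrictScalars ℚ).compLinearMap fun _ => conj := by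
    let bC := Module.Free.chooseBasis ℚ ℂ
    let bV := Module.Free.chooseBasis ℚ V
    refine Module.Basis.ext_multilinear (fun _ => bC.tensorProduct bV) fun v => ?_
    simp only [LinearMap.compMultilinearMap_apply, MultilinearMap.compLinearMap_apply,
      MultilinearMap.coe_restrictScalars, Module.Basis.tensorProduct_apply', conj_tmul, hc]
    have h1 : e.symm (PiTensorProduct.tprod ℂ fun i => bC (v i).1 ⊗ₜ[ℚ] bV (v i).2) =
        (∏ i, bC (v i).1) ⊗ₜ[ℚ] PiTensorProduct.tprod ℚ fun i => bV (v i).2 := by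
      rw [LinearEquiv.symm_apply_eq, he, piTensorBaseChange_prod_tmul_tprod]
    rw [h1, conj_tmul, map_prod, he, piTensorBaseChange_prod_tmul_tprod]
  have hx : x = e.symm (PiTensorProduct.tprod ℂ y) := by
    rw [LinearEquiv.eq_symm_apply, he, h]
  have := congrArg (fun g : MultilinearMap ℚ (fun _ : ι => ℂ ⊗[ℚ] V) _ => g y) key
  simp only [LinearMap.compMultilinearMap_apply, MultilinearMap.compLinearMap_apply,
    MultilinearMap.coe_restrictScalars, hc] at this
  rw [hx, ← he]
  exact this

/-- For subspaces `S i ⊆ V_ℂ`, complex conjugation on `ℂ ⊗ ⨂ V` carries the pull-back (along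
`piTensorBaseChange`) of the image of `⨂ᵢ S i` onto the pull-back of the image of `⨂ᵢ conj (S i)`.
The inclusion `⊆` is checked on the spanning pure tensors `⨂ₜ mᵢ`, `mᵢ ∈ S i`
(`PiTensorProduct.map_range_eq_span_tprod`, `piTensorBaseChange_conj_of_eq_tprod`), using that
`f ∘ conj ∘ f⁻¹` is additive and `ℂ`-antilinear; equality follows by applying `⊆` to `conj (S i)`
(`conj` is an involution). [folklore] -/
theorem complexConj_comap_piTensorBaseChange_range_mapIncl {ι : Type w} [Finite ι]
    (S : ι → Submodule ℂ (ℂ ⊗[ℚ] V)) :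
    complexConj ((LinearMap.range (PiTensorProduct.mapIncl S)).comap (piTensorBaseChange V ι)) =
      (LinearMap.range (PiTensorProduct.mapIncl fun i => complexConj (S i))).comap
        (piTensorBaseChange V ι) := by
  suffices key : ∀ S : ι → Submodule ℂ (ℂ ⊗[ℚ] V),
      complexConj ((LinearMap.range (PiTensorProduct.mapIncl S)).comap (piTensorBaseChange V ι)) ≤
        (LinearMap.range (PiTensorProduct.mapIncl fun i => complexConj (S i))).comap
          (piTensorBaseChange V ι) by
    refine le_antisymm (key S) ?_
    have h := complexConj_mono (key fun i => complexConj (S i))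
    rw [complexConj_complexConj] at h
    have hS : (fun i => complexConj (complexConj (S i))) = S :=
      funext fun i => complexConj_complexConj (S i)
    have e2 := congrArg (fun T : ι → Submodule ℂ (ℂ ⊗[ℚ] V) =>
      complexConj ((LinearMap.range (PiTensorProduct.mapIncl T)).comap (piTensorBaseChange V ι))) hS
    exact h.trans_eq e2
  intro S
  set e := LinearEquiv.ofBijective _ (piTensorBaseChange_bijective V ι) with he_def
  have he : ∀ z, e z = piTensorBaseChange V ι z := fun z => rfl
  have claim : ∀ t ∈ LinearMap.range (PiTensorProduct.mapIncl S),
      e (conj (e.symm t)) ∈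
        LinearMap.range (PiTensorProduct.mapIncl fun i => complexConj (S i)) := by
    intro t ht
    rw [PiTensorProduct.mapIncl, PiTensorProduct.map_range_eq_span_tprod] at ht
    induction ht using Submodule.span_induction with
    | mem t ht =>
      obtain ⟨m, rfl⟩ := ht
      have h1 : piTensorBaseChange V ι
          (e.symm (PiTensorProduct.tprod ℂ fun i => (S i).subtype (m i))) =
            PiTensorProduct.tprod ℂ fun i => (S i).subtype (m i) := by
        rw [← he, LinearEquiv.apply_symm_apply]
      rw [he, piTensorBaseChange_conj_of_eq_tprod h1]
      refine ⟨PiTensorProduct.tprod ℂ fun i => ⟨conj (m i : ℂ ⊗[ℚ] V), ?_⟩, ?_⟩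
      · simp
      · simp
    | zero => simp
    | add x y _ _ hx hy =>
      simp only [map_add]
      exact Submodule.add_mem _ hx hy
    | smul a x _ hx =>
      rw [LinearEquiv.map_smul, conj_smul, LinearEquiv.map_smul]
      exact Submodule.smul_mem _ _ hx
  intro x hx
  rw [mem_complexConj, Submodule.mem_comap] at hx
  rw [Submodule.mem_comap]
  have := claim _ hx
  rwa [← he, LinearEquiv.symm_apply_apply, conj_conj] at this

/-! ### A graded basis of `V_ℂ` adapted to `F` and `conj F` (Hodge decomposition in basis form) -/

section GradedBasis

variable {n : ℤ}

/-- **The Hodge decomposition in basis form.** For a Hodge structure `H` of weight `n` on any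
`ℚ`-space `V` there is a `ℂ`-basis `e` of `V_ℂ` and a degree `deg` on its index set with
`F^a = span {e σ | a ≤ deg σ}` and `conj F^a = span {e σ | deg σ ≤ n - a}` for all `a`: collect
bases of the Hodge pieces `V^{i,n-i}` (`DirectSum.IsInternal.collectedBasis`, using the Hodge
decomposition `V_ℂ = ⊕ᵢ V^{i,n-i}`, `F^a = ⊕_{i ≥ a} V^{i,n-i}`, `conj V^{i,n-i} = V^{n-i,i}` of
Deligne, *Théorie de Hodge II*, Prop. 1.2.5, discharged in `HodgeStructureProofs.lean`), with
`deg = i` on the basis of `V^{i,n-i}`. [cite: DeligneHodgeII1971, 1.2.5] -/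
theorem exists_basis_F_eq_span (H : HodgeStructure V n) :
    ∃ (S : Type u) (deg : S → ℤ) (e : Module.Basis S ℂ (ℂ ⊗[ℚ] V)),
      (∀ a, H.F a = Submodule.span ℂ (e '' {σ | a ≤ deg σ})) ∧
      (∀ a, complexConj (H.F a) = Submodule.span ℂ (e '' {σ | deg σ ≤ n - a})) := by
  classical
  have hind : iSupIndep fun i : ℤ => H.piece i (n - i) := iSupIndep_piece_holds H
  have htop : (⨆ i : ℤ, H.piece i (n - i)) = ⊤ := iSup_piece_eq_top_holds H
  have hF : ∀ a : ℤ, H.F a = ⨆ (i : ℤ) (_ : a ≤ i), H.piece i (n - i) := F_eq_iSup_piece_holds H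
  have hint : DirectSum.IsInternal fun i : ℤ => H.piece i (n - i) :=
    DirectSum.isInternal_submodule_of_iSupIndep_of_iSup_eq_top hind htop
  let κ : ℤ → Type u := fun i => Module.Free.ChooseBasisIndex ℂ (H.piece i (n - i))
  let e : Module.Basis (Σ i, κ i) ℂ (ℂ ⊗[ℚ] V) :=
    hint.collectedBasis fun i => Module.Free.chooseBasis ℂ (H.piece i (n - i))
  have he_mem : ∀ σ : Σ i, κ i, e σ ∈ H.piece σ.1 (n - σ.1) := fun σ =>
    hint.collectedBasis_mem _ σ
  have hpiece : ∀ i, H.piece i (n - i) ≤ Submodule.span ℂ (e '' {σ | σ.1 = i}) := by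
    intro i x hx
    rw [Module.Basis.mem_span_image]
    intro σ hσ
    by_contra hne
    rw [Finset.mem_coe, Finsupp.mem_support_iff] at hσ
    exact hσ (hint.collectedBasis_repr_of_mem_ne _ (Ne.symm hne) hx)
  refine ⟨Σ i, κ i, Sigma.fst, e, fun a => ?_, fun a => ?_⟩
  · apply le_antisymm
    · rw [hF a]
      refine iSup₂_le fun i hi => (hpiece i).trans (Submodule.span_mono (Set.image_mono ?_))
      intro σ hσ
      simp only [Set.mem_setOf_eq] at hσ ⊢
      omega
    · rw [Submodule.span_le]
      rintro _ ⟨σ, hσ, rfl⟩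
      exact (piece_le_F H _ _).trans (H.antitone_F hσ) (he_mem σ)
  · apply le_antisymm
    · have h1 : complexConj (H.F a) = ⨆ (i : ℤ) (_ : a ≤ i), H.piece (n - i) i := by
        rw [hF a, ← complexConjOrderIso_apply, OrderIso.map_iSup]
        simp only [OrderIso.map_iSup, complexConjOrderIso_apply, complexConj_piece]
      rw [h1]
      refine iSup₂_le fun i hi => ?_
      have h2 : H.piece (n - i) i = H.piece (n - i) (n - (n - i)) := by rw [sub_sub_cancel]
      rw [h2]
      refine (hpiece (n - i)).trans (Submodule.span_mono (Set.image_mono ?_))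
      intro σ hσ
      simp only [Set.mem_setOf_eq] at hσ ⊢
      omega
    · rw [Submodule.span_le]
      rintro _ ⟨σ, hσ, rfl⟩
      simp only [Set.mem_setOf_eq] at hσ
      exact (piece_le_complexConj_F H _ _).trans (complexConj_mono (H.antitone_F (by omega)))
        (he_mem σ)

variable {S : Type*} {deg : S → ℤ}

/-- In terms of a graded basis `e` of `V_ℂ` with `F^a = span {e σ | a ≤ deg σ}`, the tensor-power
filtration `F^p (V^{⊗r})` is the pull-back along `piTensorBaseChange` of the span of the tensor
basis vectors `⨂ₜ e (β k)` of total degree `Σ_k deg (β k) ≥ p` (Deligne, *Théorie de Hodge II*,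
1.1.12: `F^p` of a tensor product is `Σ_{Σ aₖ = p} ⨂ F^{aₖ}`; here computed on bases). `⊆`:
`range (⨂ F^{aₖ})` is the span of the `⨂ₜ e (β k)` with `aₖ ≤ deg (β k)`
(`HodgeTensorAux.range_mapIncl_span_basis_image`); `⊇`: `⨂ₜ e (β k) ∈ range (⨂ F^{deg (β k)})`,
pulled back along the bijection `piTensorBaseChange` (`piTensorBaseChange_bijective`).
[cite: DeligneHodgeII1971, 1.1.12] -/
theorem tensorPowerFiltration_eq_comap_span (H : HodgeStructure V n)
    (e : Module.Basis S ℂ (ℂ ⊗[ℚ] V))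
    (hF : ∀ a, H.F a = Submodule.span ℂ (e '' {σ | a ≤ deg σ})) (r : ℕ) (p : ℤ) :
    H.tensorPowerFiltration r p =
      (Submodule.span ℂ ((Basis.piTensorProduct fun _ : Fin r => e) ''
        {β | p ≤ ∑ k, deg (β k)})).comap (piTensorBaseChange V (Fin r)) := by
  set E := Basis.piTensorProduct fun _ : Fin r => e with hE_def
  have hE : ∀ β, E β = PiTensorProduct.tprod ℂ fun k => e (β k) := fun β =>
    Basis.piTensorProduct_apply _ β
  let eT := LinearEquiv.ofBijective (piTensorBaseChange V (Fin r))
    (piTensorBaseChange_bijective V (Fin r))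
  have heT : ∀ x, eT x = piTensorBaseChange V (Fin r) x := fun x => rfl
  have he_mem : ∀ σ, e σ ∈ H.F (deg σ) := fun σ => by
    rw [hF]
    exact Submodule.subset_span ⟨σ, by simp, rfl⟩
  apply le_antisymm
  · refine iSup₂_le fun a ha => Submodule.comap_mono ?_
    have h1 : LinearMap.range (PiTensorProduct.mapIncl fun i => H.F (a i)) =
        LinearMap.range (PiTensorProduct.mapIncl fun i =>
          Submodule.span ℂ (e '' {σ | a i ≤ deg σ})) :=
      congrArg (fun T : Fin r → Submodule ℂ (ℂ ⊗[ℚ] V) =>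
        LinearMap.range (PiTensorProduct.mapIncl T)) (funext fun i => hF (a i))
    rw [h1, HodgeTensorAux.range_mapIncl_span_basis_image]
    refine Submodule.span_mono (Set.image_mono fun β hβ => ?_)
    simp only [Set.mem_setOf_eq] at hβ ⊢
    exact ha.trans (Finset.sum_le_sum fun k _ => hβ k)
  · have claim : ∀ β : Fin r → S, p ≤ ∑ k, deg (β k) →
        eT.symm (E β) ∈ H.tensorPowerFiltration r p := by
      intro β hβ
      refine Submodule.mem_iSup_of_mem (fun k => deg (β k)) (Submodule.mem_iSup_of_mem hβ ?_)
      rw [Submodule.mem_comap, ← heT, LinearEquiv.apply_symm_apply, hE]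
      exact ⟨PiTensorProduct.tprod ℂ fun k => ⟨e (β k), he_mem (β k)⟩, by simp⟩
    intro x hx
    have h2 : Submodule.span ℂ (E '' {β | p ≤ ∑ k, deg (β k)}) ≤
        (H.tensorPowerFiltration r p).comap (eT.symm : _ →ₗ[ℂ] _) := by
      rw [Submodule.span_le]
      rintro _ ⟨β, hβ, rfl⟩
      exact claim β hβ
    have h3 := h2 hx
    rwa [Submodule.mem_comap, LinearEquiv.coe_coe, ← heT, LinearEquiv.symm_apply_apply] at h3

/-- In terms of a graded basis `e` of `V_ℂ` with `conj F^a = span {e σ | deg σ ≤ n - a}`, the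
conjugate `conj F^q (V^{⊗r})` of the tensor-power filtration is the pull-back along
`piTensorBaseChange` of the span of the tensor basis vectors `⨂ₜ e (β k)` of total degree
`Σ_k deg (β k) ≤ r n - q` (Deligne, *Théorie de Hodge II*, 1.1.12 and 1.2.5:
`conj F^q (⊗) = Σ_{Σ aₖ ≥ q} ⨂ conj F^{aₖ}`). Conjugation is moved inside the pull-back by
`complexConj_comap_piTensorBaseChange_range_mapIncl`; the rest is as in
`tensorPowerFiltration_eq_comap_span`, with `aₖ := n - deg (β k)` for `⊇`.
[cite: DeligneHodgeII1971, 1.1.12 and 1.2.5] -/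
theorem complexConj_tensorPowerFiltration_eq_comap_span (H : HodgeStructure V n)
    (e : Module.Basis S ℂ (ℂ ⊗[ℚ] V))
    (hFc : ∀ a, complexConj (H.F a) = Submodule.span ℂ (e '' {σ | deg σ ≤ n - a})) (r : ℕ) (q : ℤ) :
    complexConj (H.tensorPowerFiltration r q) =
      (Submodule.span ℂ ((Basis.piTensorProduct fun _ : Fin r => e) ''
        {β | ∑ k, deg (β k) ≤ r * n - q})).comap (piTensorBaseChange V (Fin r)) := by
  set E := Basis.piTensorProduct fun _ : Fin r => e with hE_def
  have hE : ∀ β, E β = PiTensorProduct.tprod ℂ fun k => e (β k) := fun β =>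
    Basis.piTensorProduct_apply _ β
  let eT := LinearEquiv.ofBijective (piTensorBaseChange V (Fin r))
    (piTensorBaseChange_bijective V (Fin r))
  have heT : ∀ x, eT x = piTensorBaseChange V (Fin r) x := fun x => rfl
  have he_mem : ∀ σ, e σ ∈ complexConj (H.F (n - deg σ)) := fun σ => by
    rw [hFc]
    exact Submodule.subset_span ⟨σ, by simp, rfl⟩
  have hrn : ∀ a : Fin r → ℤ, ∑ k, (n - a k) = r * n - ∑ k, a k := by
    intro a
    rw [Finset.sum_sub_distrib, Finset.sum_const, Finset.card_univ, Fintype.card_fin, nsmul_eq_mul]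
  have h0 : complexConj (H.tensorPowerFiltration r q) = ⨆ (a : Fin r → ℤ) (_ : q ≤ ∑ i, a i),
      (LinearMap.range (PiTensorProduct.mapIncl fun i => complexConj (H.F (a i)))).comap
        (piTensorBaseChange V (Fin r)) := by
    rw [tensorPowerFiltration, ← complexConjOrderIso_apply, OrderIso.map_iSup]
    simp only [OrderIso.map_iSup, complexConjOrderIso_apply,
      complexConj_comap_piTensorBaseChange_range_mapIncl]
  rw [h0]
  apply le_antisymm
  · refine iSup₂_le fun a ha => Submodule.comap_mono ?_
    have h1 : LinearMap.range (PiTensorProduct.mapIncl fun i => complexConj (H.F (a i))) =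
        LinearMap.range (PiTensorProduct.mapIncl fun i =>
          Submodule.span ℂ (e '' {σ | deg σ ≤ n - a i})) :=
      congrArg (fun T : Fin r → Submodule ℂ (ℂ ⊗[ℚ] V) =>
        LinearMap.range (PiTensorProduct.mapIncl T)) (funext fun i => hFc (a i))
    rw [h1, HodgeTensorAux.range_mapIncl_span_basis_image]
    refine Submodule.span_mono (Set.image_mono fun β hβ => ?_)
    simp only [Set.mem_setOf_eq] at hβ ⊢
    have h4 : ∑ k, deg (β k) ≤ ∑ k, (n - a k) := Finset.sum_le_sum fun k _ => hβ k
    rw [hrn] at h4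
    omega
  · have claim : ∀ β : Fin r → S, ∑ k, deg (β k) ≤ r * n - q →
        eT.symm (E β) ∈ ⨆ (a : Fin r → ℤ) (_ : q ≤ ∑ i, a i),
          (LinearMap.range (PiTensorProduct.mapIncl fun i => complexConj (H.F (a i)))).comap
            (piTensorBaseChange V (Fin r)) := by
      intro β hβ
      have hq : q ≤ ∑ k, (n - deg (β k)) := by rw [hrn]; omega
      refine Submodule.mem_iSup_of_mem (fun k => n - deg (β k)) (Submodule.mem_iSup_of_mem hq ?_)
      rw [Submodule.mem_comap, ← heT, LinearEquiv.apply_symm_apply, hE]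
      exact ⟨PiTensorProduct.tprod ℂ fun k => ⟨e (β k), he_mem (β k)⟩, by simp⟩
    intro x hx
    have h2 : Submodule.span ℂ (E '' {β | ∑ k, deg (β k) ≤ r * n - q}) ≤
        (⨆ (a : Fin r → ℤ) (_ : q ≤ ∑ i, a i), (LinearMap.range
          (PiTensorProduct.mapIncl fun i => complexConj (H.F (a i)))).comap
            (piTensorBaseChange V (Fin r))).comap (eT.symm : _ →ₗ[ℂ] _) := by
      rw [Submodule.span_le]
      rintro _ ⟨β, hβ, rfl⟩
      exact claim β hβ
    have h3 := h2 hx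
    rwa [Submodule.mem_comap, LinearEquiv.coe_coe, ← heT, LinearEquiv.symm_apply_apply] at h3

end GradedBasis

/-! ### The discharge -/

section Discharges

variable {n : ℤ}

/-- **Opposedness of the tensor-power filtration** (discharges the named fact
`isCompl_tensorPowerFiltration`): for a Hodge structure `H` of weight `n` on any `ℚ`-space `V`
and `p + q = r n + 1`, `F^p (V^{⊗r}) ⊕ conj F^q (V^{⊗r}) = ℂ ⊗ V^{⊗r}`. Source: Deligne,
*Théorie de Hodge II*, 1.1.12 (filtration on a tensor product) with Prop. 1.2.5 (opposed
filtrations ↔ bigradings): the bigrading `⊕ V^{i₁,n-i₁} ⊗ ⋯ ⊗ V^{i_r,n-i_r}` of `(V_ℂ)^{⊗r}`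
splits `F^p (⊗) = ⊕_{Σ iₖ ≥ p}` and `conj F^q (⊗) = ⊕_{Σ iₖ ≤ rn - q} = ⊕_{Σ iₖ < p}`; cf.
Cattani–El Zein–Griffiths–Lê, *Hodge Theory*, §3.1.1.3. In the proof the bigrading is realised by
the tensor basis of a graded basis of `V_ℂ` (`exists_basis_F_eq_span`,
`tensorPowerFiltration_eq_comap_span`, `complexConj_tensorPowerFiltration_eq_comap_span`), the two
spans of complementary sets of basis vectors are complementary
(`HodgeTensorAux.isCompl_span_basis_image_compl`), and complements pull back along the bijection
`piTensorBaseChange` (`piTensorBaseChange_bijective`).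
[cite: DeligneHodgeII1971, 1.1.12 and 1.2.5] -/
theorem isCompl_tensorPowerFiltration_holds :
    isCompl_tensorPowerFiltration (V := V) (n := n) := by
  intro H r p q hpq
  obtain ⟨S, deg, e, hF, hFc⟩ := exists_basis_F_eq_span H
  rw [tensorPowerFiltration_eq_comap_span H e hF r p,
    complexConj_tensorPowerFiltration_eq_comap_span H e hFc r q]
  set E := Basis.piTensorProduct fun _ : Fin r => e
  let eT := LinearEquiv.ofBijective (piTensorBaseChange V (Fin r))
    (piTensorBaseChange_bijective V (Fin r))
  have h5 : {β : Fin r → S | ∑ k, deg (β k) ≤ r * n - q} = {β | p ≤ ∑ k, deg (β k)}ᶜ := by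
    ext β
    simp only [Set.mem_setOf_eq, Set.mem_compl_iff, not_le]
    omega
  rw [h5]
  exact ((Submodule.orderIsoMapComap eT).symm.isCompl_iff).1
    (HodgeTensorAux.isCompl_span_basis_image_compl E _)

end Discharges

end HodgeStructure

end Literature.AlgebraicGeometry.Motives

end
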